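import Literature.Barriers.QuantumAdvantage.UncorrectedNoiseFourier
import HarnessLib

/-!
# Uncorrected noise, sampling side: BMS17 §3.2 and Appendix — sampling from an approximate distribution through its marginals

Support file for the discharge of `bremnerMontanaroShepherd2017_thm4`
(`Literature/Barriers/QuantumAdvantage/UncorrectedNoise.lean`). Bremner–Montanaro–Shepherd 2017,
§3.2 and Appendix "Sampling from an approximate distribution": given exact access to the prefix
sums (marginals) `S_y` of a real vector `p'` on `{0,1}^N` that is `δ`-close in `ℓ₁` to a
probability vector `p`, the truncated sequential sampler `Alg` outputs a distribution within
`4δ/(1−δ)` of `p`. Fully proved, in a form that also covers the coin-driven machine: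

* `branchWeight a b` — the paper's step rule (probability of appending `0` given the child
  marginals `a = S_{y0}`, `b = S_{y1}`: `0` if `a < 0`, `1` if `b < 0`, else `a/(a+b)`);
* `algR R N p` — `Alg(p)` with a *rounding* `R : ℝ → ℝ` applied to every branch probability
  (`R = id` is the paper's `Alg`; `R = ⌈2^m ·⌉/2^m` is what `m` fair coins per bit realise);
  `sum_algR` (it is a probability vector), `algR_nonneg`;
* Lemma 11/12 in the form `fix_claims`, `l1_fix_sub_eq` for `Fix(p) = (Σp)·Alg(p)`:
  `‖Fix(p) − p‖₁ = 2 Σ_{p_x<0} |p_x|` [BMS17 App., Lemmas 11–12];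
* **Lemma 10** `l1_alg_sub_le`: `‖Alg(p') − p‖₁ ≤ 4δ/(1−δ)` [BMS17 Lemma 10];
* rounding costs little: `l1_algR_sub_alg_le`: `‖Alg_R(p) − Alg(p)‖₁ ≤ 2Nκ` when `|R t − t| ≤ κ`
  on `[0,1]` (hybrid argument over the `N` steps) [folklore];
* the iterative (prefix-sum) form of the sampler, `algR_eq_prod_stepProb`: `Alg_R(p)(x) = ∏_k`
  (branch probability at step `k` computed from `S_{x↾k 0}`, `S_{x↾k 1}` of
  `UncorrectedNoiseFourier.prefixSum`), which is how a machine runs it [BMS17 §3.2, the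
  enumerated procedure];
* packaging: `algPMF` (the output law as a `PMF`), `tvDist_map_of_injective`.

## References

* [BremnerMontanaroShepherd2017] M. J. Bremner, A. Montanaro, D. J. Shepherd, *Achieving quantum
  supremacy with sparse and noisy commuting quantum computations*, Quantum 1 (2017) 8, §3.2,
  Lemma 10, Appendix (Lemmas 11, 12).
-/

noncomputable section

namespace Literature.Barriers.QuantumAdvantage

open Finset
open scoped NNReal ENNReal

variable {N : ℕ}

/-! ### Halves of the cube and total mass -/

/-- Total mass `Σ_x p(x)`. [folklore] -/
def tot (p : (Fin N → Bool) → ℝ) : ℝ := ∑ x, p x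

/-- The half of `p` on the points with first bit `b` (a function on `{0,1}^N`).
[cite: BremnerMontanaroShepherd2017, Appendix (p = (a; b))] -/
def half (p : (Fin (N + 1) → Bool) → ℝ) (b : Bool) : (Fin N → Bool) → ℝ := fun z => p (Fin.cons b z)

/-- Summing over `{0,1}^{N+1}` = summing over the first bit and the rest. [folklore] -/
theorem sum_cube_succ {M : Type*} [AddCommMonoid M] (f : (Fin (N + 1) → Bool) → M) :
    ∑ x, f x = ∑ b : Bool, ∑ z : Fin N → Bool, f (Fin.cons b z) := by
  rw [← Fintype.sum_prod_type (fun q : Bool × (Fin N → Bool) => f (Fin.cons q.1 q.2))]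
  exact Fintype.sum_equiv (Fin.consEquiv fun _ => Bool).symm _ _ fun x => by
    simp only [Fin.consEquiv, Equiv.coe_fn_symm_mk]
    rw [Fin.cons_self_tail]

/-- `Σ p = Σ a + Σ b` for the two halves. [cite: BremnerMontanaroShepherd2017, Appendix] -/
theorem tot_eq_add (p : (Fin (N + 1) → Bool) → ℝ) : tot p = tot (half p false) + tot (half p true) := by
  unfold tot half
  rw [sum_cube_succ, Fintype.sum_bool, add_comm]

/-- On `{0,1}^0` the total mass is the single value. [folklore] -/
theorem tot_zero (p : (Fin 0 → Bool) → ℝ) (x : Fin 0 → Bool) : tot p = p x := by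
  unfold tot
  rw [Fintype.sum_unique]
  congr 1
  exact Subsingleton.elim _ _

/-! ### The step rule and the (rounded) sampler -/

/-- **The step rule of §3.2**: given the child marginals `a = S_{y0}` and `b = S_{y1}`, append `0`
with probability `0` if `a < 0`, `1` if `b < 0` (at most one of these happens along the run), and
`a/(a+b) = S_{y0}/S_y` otherwise (junk `0` if `a = b = 0`, never reached).
[cite: BremnerMontanaroShepherd2017, §3.2 (procedure, steps 2(a)–(b))] -/
def branchWeight (a b : ℝ) : ℝ := if a < 0 then 0 else if b < 0 then 1 else a / (a + b)

/-- The step rule is a probability. [folklore] -/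
theorem branchWeight_nonneg (a b : ℝ) : 0 ≤ branchWeight a b := by
  unfold branchWeight
  split_ifs with h1 h2
  · exact le_rfl
  · exact zero_le_one
  · push Not at h1 h2; exact div_nonneg h1 (add_nonneg h1 h2)

/-- The step rule is a probability. [folklore] -/
theorem branchWeight_le_one (a b : ℝ) : branchWeight a b ≤ 1 := by
  unfold branchWeight
  split_ifs with h1 h2
  · exact zero_le_one
  · exact le_rfl
  · push Not at h1 h2
    rcases (add_nonneg h1 h2).eq_or_lt with h | h
    · rw [← h, div_zero]; exact zero_le_one
    · rw [div_le_one h]; linarith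

/-- **The sampler `Alg` with rounded branch probabilities.** `algR R N p x` is the probability that
the sequential procedure of §3.2, deciding the bits in order and using `R` of the step rule as the
probability of appending `0`, outputs `x`; `R = id` is the paper's `Alg(p)`.
[cite: BremnerMontanaroShepherd2017, §3.2 (the distribution Alg(p'))] -/
def algR (R : ℝ → ℝ) : (N : ℕ) → ((Fin N → Bool) → ℝ) → (Fin N → Bool) → ℝ
  | 0, _, _ => 1
  | N + 1, p, x =>
      (if x 0 = true then 1 - R (branchWeight (tot (half p false)) (tot (half p true)))
        else R (branchWeight (tot (half p false)) (tot (half p true)))) *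
      algR R N (half p (x 0)) (Fin.tail x)

/-- Unfolding `algR` at a point written as `cons b z`. [folklore] -/
theorem algR_succ_cons (R : ℝ → ℝ) (p : (Fin (N + 1) → Bool) → ℝ) (b : Bool) (z : Fin N → Bool) :
    algR R (N + 1) p (Fin.cons b z) =
      (if b = true then 1 - R (branchWeight (tot (half p false)) (tot (half p true)))
        else R (branchWeight (tot (half p false)) (tot (half p true)))) * algR R N (half p b) z := by
  rw [algR, Fin.cons_zero, Fin.tail_cons]

/-- **`Alg_R(p)` is a probability vector**: `Σ_x Alg_R(p)(x) = 1` (for any rounding).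
[cite: BremnerMontanaroShepherd2017, §3.2 ("this procedure defines a probability distribution")] -/
theorem sum_algR (R : ℝ → ℝ) : ∀ (N : ℕ) (p : (Fin N → Bool) → ℝ), ∑ x, algR R N p x = 1
  | 0, p => by simp [algR]
  | N + 1, p => by
    rw [sum_cube_succ]
    simp_rw [algR_succ_cons, ← Finset.mul_sum, sum_algR R N]
    simp

/-- A rounding that keeps probabilities in `[0, 1]`. [folklore] -/
def RoundingOK (R : ℝ → ℝ) : Prop := ∀ t, 0 ≤ t → t ≤ 1 → 0 ≤ R t ∧ R t ≤ 1

/-- The identity is an admissible rounding. [folklore] -/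
theorem roundingOK_id : RoundingOK id := fun _ h0 h1 => ⟨h0, h1⟩

/-- `Alg_R(p) ≥ 0` for admissible roundings. [folklore] -/
theorem algR_nonneg {R : ℝ → ℝ} (hR : RoundingOK R) : ∀ (N : ℕ) (p : (Fin N → Bool) → ℝ) (x : Fin N → Bool),
    0 ≤ algR R N p x
  | 0, p, x => by simp [algR]
  | N + 1, p, x => by
    rw [algR]
    refine mul_nonneg ?_ (algR_nonneg hR N _ _)
    have h := hR _ (branchWeight_nonneg (tot (half p false)) (tot (half p true)))
      (branchWeight_le_one _ _)
    split_ifs <;> linarith [h.1, h.2]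

/-! ### Lemmas 11 and 12: `Fix(p) = (Σ p) · Alg(p)` -/

/-- Scaling by `c ∈ [0,1]` preserves the two pointwise claims of Lemma 12. [folklore] -/
theorem fix_claims_scale {q v c : ℝ} (hc0 : 0 ≤ c) (hc1 : c ≤ 1)
    (h : (0 ≤ q → 0 ≤ v ∧ v ≤ q) ∧ (q < 0 → v = 0)) :
    (0 ≤ q → 0 ≤ c * v ∧ c * v ≤ q) ∧ (q < 0 → c * v = 0) := by
  refine ⟨fun hq => ?_, fun hq => by rw [h.2 hq, mul_zero]⟩
  obtain ⟨h0, h1⟩ := h.1 hq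
  exact ⟨mul_nonneg hc0 h0, by nlinarith⟩

/-- The value `0` satisfies the two pointwise claims of Lemma 12. [folklore] -/
theorem fix_claims_zero (q : ℝ) : (0 ≤ q → (0 : ℝ) ≤ 0 ∧ (0 : ℝ) ≤ q) ∧ (q < 0 → (0 : ℝ) = 0) :=
  ⟨fun hq => ⟨le_rfl, hq⟩, fun _ => rfl⟩

/-- **Lemma 12, claims 1–2** for `Fix(p) = (Σp)·Alg(p)` (Lemma 11): if `Σ p > 0` then
`0 ≤ Fix(p)_x ≤ p_x` where `p_x ≥ 0`, and `Fix(p)_x = 0` where `p_x < 0`.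
[cite: BremnerMontanaroShepherd2017, Appendix, Lemma 11 and Lemma 12 (claims 1, 2)] -/
theorem fix_claims : ∀ (N : ℕ) (p : (Fin N → Bool) → ℝ), 0 < tot p → ∀ x : Fin N → Bool,
    (0 ≤ p x → 0 ≤ tot p * algR id N p x ∧ tot p * algR id N p x ≤ p x) ∧
    (p x < 0 → tot p * algR id N p x = 0)
  | 0, p, hp, x => by
    rw [tot_zero p x] at hp ⊢
    simp only [algR, mul_one]
    exact ⟨fun _ => ⟨hp.le, le_rfl⟩, fun h => absurd hp (not_lt.2 h.le)⟩
  | N + 1, p, hp, x => by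
    -- write `x = cons b z`
    have hx : x = Fin.cons (x 0) (Fin.tail x) := (Fin.cons_self_tail x).symm
    set b := x 0 with hb
    set z := Fin.tail x with hz
    rw [hx, algR_succ_cons]
    have hpx : p (Fin.cons b z) = half p b z := rfl
    rw [hpx]
    set A := tot (half p false) with hA
    set B := tot (half p true) with hB
    have hAB : tot p = A + B := tot_eq_add p
    rw [hAB] at hp ⊢
    simp only [id]
    cases b
    · -- first bit `0`: weight `branchWeight A B`
      simp only [Bool.false_eq_true, if_false]
      unfold branchWeight
      by_cases hA0 : A < 0
      · rw [if_pos hA0, zero_mul, mul_zero]; exact fix_claims_zero _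
      · rw [if_neg hA0]
        push Not at hA0
        by_cases hB0 : B < 0
        · rw [if_pos hB0, one_mul]
          have hApos : 0 < A := by linarith
          have ih := fix_claims N (half p false) hApos z
          rw [show (A + B) * algR id N (half p false) z = ((A + B) / A) * (A * algR id N (half p false) z) by
            field_simp]
          exact fix_claims_scale (div_nonneg hp.le hApos.le) (by rw [div_le_one hApos]; linarith) ih
        · rw [if_neg hB0]
          push Not at hB0
          rw [show (A + B) * (A / (A + B) * algR id N (half p false) z) = A * algR id N (half p false) z by
            field_simp]
          rcases hA0.eq_or_lt with hA00 | hApos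
          · rw [← hA00, zero_mul]; exact fix_claims_zero _
          · exact fix_claims N (half p false) hApos z
    · -- first bit `1`: weight `1 - branchWeight A B`
      simp only [if_true]
      unfold branchWeight
      by_cases hA0 : A < 0
      · rw [if_pos hA0, sub_zero, one_mul]
        have hBpos : 0 < B := by linarith
        have ih := fix_claims N (half p true) hBpos z
        rw [show (A + B) * algR id N (half p true) z = ((A + B) / B) * (B * algR id N (half p true) z) by
          field_simp]
        exact fix_claims_scale (div_nonneg hp.le hBpos.le) (by rw [div_le_one hBpos]; linarith) ih
      · rw [if_neg hA0]
        push Not at hA0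
        by_cases hB0 : B < 0
        · rw [if_pos hB0, sub_self, zero_mul, mul_zero]; exact fix_claims_zero _
        · rw [if_neg hB0]
          push Not at hB0
          rw [show (A + B) * ((1 - A / (A + B)) * algR id N (half p true) z) = B * algR id N (half p true) z by
            field_simp; ring]
          rcases hB0.eq_or_lt with hB00 | hBpos
          · rw [← hB00, zero_mul]; exact fix_claims_zero _
          · exact fix_claims N (half p true) hBpos z

/-- **Lemma 12**: `‖Fix(p) − p‖₁ = 2 Σ_{p_x < 0} |p_x|` for `Σ p > 0`.
[cite: BremnerMontanaroShepherd2017, Appendix, Lemma 12] -/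
theorem l1_fix_sub_eq (p : (Fin N → Bool) → ℝ) (hp : 0 < tot p) :
    ∑ x, |tot p * algR id N p x - p x| = 2 * ∑ x ∈ univ.filter (fun x => p x < 0), |p x| := by
  have hc := fix_claims N p hp
  -- split both sides along the sign of `p`
  rw [← Finset.sum_filter_add_sum_filter_not univ (fun x => p x < 0)]
  have hneg : ∑ x ∈ univ.filter (fun x => p x < 0), |tot p * algR id N p x - p x| =
      ∑ x ∈ univ.filter (fun x => p x < 0), |p x| := by
    refine Finset.sum_congr rfl fun x hx => ?_
    rw [Finset.mem_filter] at hx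
    rw [(hc x).2 hx.2, zero_sub, abs_neg]
  have hpos : ∑ x ∈ univ.filter (fun x => ¬ p x < 0), |tot p * algR id N p x - p x| =
      ∑ x ∈ univ.filter (fun x => ¬ p x < 0), p x - ∑ x ∈ univ.filter (fun x => ¬ p x < 0), tot p * algR id N p x := by
    rw [← Finset.sum_sub_distrib]
    refine Finset.sum_congr rfl fun x hx => ?_
    rw [Finset.mem_filter, not_lt] at hx
    obtain ⟨h0, h1⟩ := (hc x).1 hx.2
    rw [abs_sub_comm, abs_of_nonneg (by linarith)]
  -- `Σ_{p ≥ 0} Fix = Σ Fix = Σ p`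
  have hfixsum : ∑ x ∈ univ.filter (fun x => ¬ p x < 0), tot p * algR id N p x = tot p := by
    have h1 : ∑ x, tot p * algR id N p x = tot p := by rw [← Finset.mul_sum, sum_algR, mul_one]
    rw [← Finset.sum_filter_add_sum_filter_not univ (fun x => p x < 0)] at h1
    have h0 : ∑ x ∈ univ.filter (fun x => p x < 0), tot p * algR id N p x = 0 :=
      Finset.sum_eq_zero fun x hx => (hc x).2 (Finset.mem_filter.1 hx).2
    linarith
  have htot : tot p = ∑ x ∈ univ.filter (fun x => p x < 0), p x + ∑ x ∈ univ.filter (fun x => ¬ p x < 0), p x :=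
    (Finset.sum_filter_add_sum_filter_not univ (fun x => p x < 0) p).symm
  have habs : ∑ x ∈ univ.filter (fun x => p x < 0), |p x| = - ∑ x ∈ univ.filter (fun x => p x < 0), p x := by
    rw [← Finset.sum_neg_distrib]
    refine Finset.sum_congr rfl fun x hx => ?_
    rw [Finset.mem_filter] at hx
    exact abs_of_neg hx.2
  rw [hneg, hpos, hfixsum, habs]
  linarith

/-! ### Lemma 10 -/

/-- **Lemma 10 (Bremner–Montanaro–Shepherd).** Let `p` be a probability vector on `{0,1}^N` and
`p'` any real vector with `‖p' − p‖₁ ≤ δ < 1`. Then `‖Alg(p') − p‖₁ ≤ 4δ/(1−δ)`.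
[cite: BremnerMontanaroShepherd2017, Lemma 10 (proof in the Appendix)] -/
theorem l1_alg_sub_le (p p' : (Fin N → Bool) → ℝ) (hp0 : ∀ x, 0 ≤ p x) (hp1 : ∑ x, p x = 1)
    {δ : ℝ} (hδ : ∑ x, |p' x - p x| ≤ δ) (hδ1 : δ < 1) :
    ∑ x, |algR id N p' x - p x| ≤ 4 * δ / (1 - δ) := by
  set S := tot p' with hS
  -- `|S - 1| ≤ δ`
  have hS1 : |S - 1| ≤ δ := by
    have : S - 1 = ∑ x, (p' x - p x) := by rw [Finset.sum_sub_distrib, hp1]; rfl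
    rw [this]
    exact (Finset.abs_sum_le_sum_abs _ _).trans hδ
  have hSpos : 0 < S := by have := (abs_le.1 hS1).1; linarith
  have hSge : 1 - δ ≤ S := by have := (abs_le.1 hS1).1; linarith
  have h1δ : 0 < 1 - δ := by linarith
  -- the three terms of the triangle inequality
  have hterm : ∀ x, |algR id N p' x - p x| ≤
      S⁻¹ * |S * algR id N p' x - p' x| + S⁻¹ * |p' x - p x| + |S⁻¹ - 1| * p x := by
    intro x
    have e : algR id N p' x - p x =
        S⁻¹ * (S * algR id N p' x - p' x) + S⁻¹ * (p' x - p x) + (S⁻¹ - 1) * p x := by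
      field_simp; ring
    rw [e]
    refine (abs_add_le _ _).trans (add_le_add ((abs_add_le _ _).trans (add_le_add ?_ ?_)) ?_)
    · rw [abs_mul, abs_of_pos (inv_pos.2 hSpos)]
    · rw [abs_mul, abs_of_pos (inv_pos.2 hSpos)]
    · rw [abs_mul, abs_of_nonneg (hp0 x)]
  refine (Finset.sum_le_sum fun x _ => hterm x).trans ?_
  rw [Finset.sum_add_distrib, Finset.sum_add_distrib, ← Finset.mul_sum, ← Finset.mul_sum, ← Finset.mul_sum,
    hp1, mul_one, l1_fix_sub_eq p' hSpos]
  -- `Σ_{p' < 0} |p'| ≤ δ`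
  have hnegmass : ∑ x ∈ univ.filter (fun x => p' x < 0), |p' x| ≤ δ := by
    refine le_trans ?_ ((Finset.sum_le_sum_of_subset_of_nonneg
      (Finset.filter_subset (fun x => p' x < 0) (univ : Finset (Fin N → Bool)))
      (fun x _ _ => abs_nonneg (p' x - p x))).trans hδ)
    refine Finset.sum_le_sum fun x hx => ?_
    rw [Finset.mem_filter] at hx
    rw [abs_of_neg hx.2, abs_sub_comm, abs_of_nonneg (by linarith [hp0 x])]
    linarith [hp0 x]
  have hinv : S⁻¹ ≤ (1 - δ)⁻¹ := by
    rw [inv_le_inv₀ hSpos h1δ]; exact hSge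
  have hinv0 : 0 ≤ S⁻¹ := inv_nonneg.2 hSpos.le
  have hthird : |S⁻¹ - 1| ≤ δ / (1 - δ) := by
    rw [show S⁻¹ - 1 = (1 - S) * S⁻¹ by field_simp, abs_mul, abs_of_nonneg hinv0, abs_sub_comm,
      div_eq_mul_inv]
    exact mul_le_mul hS1 hinv hinv0 (by linarith [abs_nonneg (S - 1)])
  calc S⁻¹ * (2 * ∑ x ∈ univ.filter (fun x => p' x < 0), |p' x|) + S⁻¹ * ∑ x, |p' x - p x| + |S⁻¹ - 1|
      ≤ (1 - δ)⁻¹ * (2 * δ) + (1 - δ)⁻¹ * δ + δ / (1 - δ) := by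
        refine add_le_add (add_le_add ?_ ?_) hthird
        · exact mul_le_mul hinv (by linarith) (by positivity) (by positivity)
        · exact mul_le_mul hinv hδ (by positivity) (by positivity)
    _ = 4 * δ / (1 - δ) := by
        field_simp; ring

/-! ### Rounding the branch probabilities costs `2Nκ` in `ℓ₁` -/

/-- **Hybrid bound for rounded branch probabilities**: if `|R t − t| ≤ κ` and `R t ∈ [0,1]` for
`t ∈ [0,1]`, then `‖Alg_R(p) − Alg(p)‖₁ ≤ 2Nκ` (one `2κ` per decided bit). [folklore] -/
theorem l1_algR_sub_alg_le {R : ℝ → ℝ} {κ : ℝ} (hR : RoundingOK R)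
    (hκ : ∀ t, 0 ≤ t → t ≤ 1 → |R t - t| ≤ κ) :
    ∀ (N : ℕ) (p : (Fin N → Bool) → ℝ), ∑ x, |algR R N p x - algR id N p x| ≤ 2 * N * κ
  | 0, p => by simp [algR]
  | N + 1, p => by
    rw [sum_cube_succ]
    simp_rw [algR_succ_cons]
    set w := branchWeight (tot (half p false)) (tot (half p true)) with hw
    have hw0 : 0 ≤ w := branchWeight_nonneg _ _
    have hw1 : w ≤ 1 := branchWeight_le_one _ _
    have hRw := hR w hw0 hw1
    have hκw := hκ w hw0 hw1
    have hκ0 : 0 ≤ κ := (abs_nonneg _).trans hκw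
    -- one half: weight `W'` (rounded) against `W` (exact)
    have key : ∀ (b : Bool) (W' W : ℝ), |W' - W| ≤ κ → 0 ≤ W →
        ∑ z : Fin N → Bool, |W' * algR R N (half p b) z - W * algR id N (half p b) z| ≤ κ + W * (2 * N * κ) := by
      intro b W' W hW hW0
      have ih := l1_algR_sub_alg_le hR hκ N (half p b)
      calc ∑ z : Fin N → Bool, |W' * algR R N (half p b) z - W * algR id N (half p b) z|
          ≤ ∑ z : Fin N → Bool, (|W' - W| * algR R N (half p b) z +
              W * |algR R N (half p b) z - algR id N (half p b) z|) := by
            refine Finset.sum_le_sum fun z _ => ?_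
            have e : W' * algR R N (half p b) z - W * algR id N (half p b) z =
                (W' - W) * algR R N (half p b) z + W * (algR R N (half p b) z - algR id N (half p b) z) := by ring
            rw [e]
            refine (abs_add_le _ _).trans (add_le_add ?_ ?_)
            · rw [abs_mul, abs_of_nonneg (algR_nonneg hR N _ z)]
            · rw [abs_mul, abs_of_nonneg hW0]
        _ = |W' - W| * ∑ z : Fin N → Bool, algR R N (half p b) z +
              W * ∑ z : Fin N → Bool, |algR R N (half p b) z - algR id N (half p b) z| := by
            rw [Finset.sum_add_distrib, Finset.mul_sum, Finset.mul_sum]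
        _ ≤ κ + W * (2 * N * κ) := by
            rw [sum_algR, mul_one]
            exact add_le_add hW (mul_le_mul_of_nonneg_left ih hW0)
    rw [Fintype.sum_bool]
    simp only [if_true, Bool.false_eq_true, if_false, id]
    have h1 := key true (1 - R w) (1 - w) (by rw [show (1 - R w) - (1 - w) = -(R w - w) by ring, abs_neg]; exact hκw)
      (by linarith)
    have h2 := key false (R w) w hκw hw0
    calc _ ≤ (κ + (1 - w) * (2 * N * κ)) + (κ + w * (2 * N * κ)) := add_le_add h1 h2
      _ = 2 * (N + 1 : ℕ) * κ := by push_cast; ring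

/-! ### The iterative form: branch probabilities from prefix sums -/

/-- A point of the cube as a prefix function on `ℕ` (`false` beyond `N`). [folklore] -/
def extendFin (x : Fin N → Bool) : ℕ → Bool := fun i => if h : i < N then x ⟨i, h⟩ else false

/-- The prefix function at `0`. [folklore] -/
@[simp] theorem extendFin_zero (x : Fin (N + 1) → Bool) : extendFin x 0 = x 0 := by
  simp [extendFin]

/-- Prepending a bit to a prefix function. [folklore] -/
def consN (b : Bool) (y : ℕ → Bool) : ℕ → Bool := fun i => if i = 0 then b else y (i - 1)

/-- `extendFin (cons b z) = consN b (extendFin z)`. [folklore] -/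
theorem extendFin_cons (b : Bool) (z : Fin N → Bool) : extendFin (Fin.cons b z : Fin (N + 1) → Bool) = consN b (extendFin z) := by
  funext i
  simp only [extendFin, consN]
  rcases Nat.eq_zero_or_pos i with rfl | hi
  · simp
  · rw [if_neg (Nat.pos_iff_ne_zero.1 hi)]
    by_cases h : i < N + 1
    · rw [dif_pos h, dif_pos (by omega)]
      have : (⟨i, h⟩ : Fin (N + 1)) = Fin.succ ⟨i - 1, by omega⟩ := by ext; simp; omega
      rw [this, Fin.cons_succ]
    · rw [dif_neg h, dif_neg (by omega)]

/-- Updating behind the prepended bit. [folklore] -/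
theorem update_consN_succ (b : Bool) (y : ℕ → Bool) (k : ℕ) (c : Bool) :
    Function.update (consN b y) (k + 1) c = consN b (Function.update y k c) := by
  funext i
  unfold consN
  by_cases hi : i = k + 1
  · subst hi; simp
  · rw [Function.update_of_ne hi]
    by_cases h0 : i = 0
    · simp [h0]
    · rw [if_neg h0, if_neg h0, Function.update_of_ne (by omega)]

/-- The prefix cube behind a prepended bit. [folklore] -/
theorem cons_mem_prefixCube_succ_iff (k : ℕ) (b c : Bool) (y : ℕ → Bool) (z : Fin N → Bool) :
    (Fin.cons c z : Fin (N + 1) → Bool) ∈ prefixCube (k + 1) (consN b y) ↔ c = b ∧ z ∈ prefixCube k y := by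
  rw [mem_prefixCube, mem_prefixCube]
  constructor
  · intro h
    refine ⟨by simpa [consN] using h 0 (Nat.succ_pos k), fun i hi => ?_⟩
    have := h i.succ (by simp; omega)
    simpa [consN] using this
  · rintro ⟨rfl, hz⟩ i hi
    refine Fin.cases ?_ (fun j hj => ?_) i hi
    · simp [consN]
    · simp only [Fin.val_succ] at hj
      simp only [Fin.cons_succ, consN, Fin.val_succ, Nat.succ_ne_zero, if_false, Nat.add_sub_cancel]
      exact hz j (by omega)

/-- A sum over a prefix cube as a sum of an indicator over the whole cube. [folklore] -/
theorem sum_prefixCube_eq_ite {M : Type*} [AddCommMonoid M] {n : ℕ} (q : (Fin n → Bool) → M) (k : ℕ) (y : ℕ → Bool) :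
    ∑ x ∈ prefixCube k y, q x = ∑ x, if x ∈ prefixCube k y then q x else 0 := by
  rw [Finset.sum_ite_mem, Finset.univ_inter]

/-- **Prefix sums of a half**: `S^{half b}_{y} = S_{b y}`. [folklore] -/
theorem prefixSum_half (p : (Fin (N + 1) → Bool) → ℝ) (b : Bool) (k : ℕ) (y : ℕ → Bool) :
    prefixSum (half p b) k y = prefixSum p (k + 1) (consN b y) := by
  unfold prefixSum
  rw [sum_prefixCube_eq_ite, sum_prefixCube_eq_ite, sum_cube_succ]
  simp_rw [cons_mem_prefixCube_succ_iff]
  rw [Fintype.sum_bool]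
  cases b <;> simp [half]

/-- The first marginal is the mass of a half: `S_{b} = Σ (half p b)`. [folklore] -/
theorem prefixSum_one_eq_tot_half (p : (Fin (N + 1) → Bool) → ℝ) (y : ℕ → Bool) :
    prefixSum p 1 y = tot (half p (y 0)) := by
  have h : y = consN (y 0) (fun i => y (i + 1)) := by
    funext i
    simp only [consN]
    split_ifs with h0
    · rw [h0]
    · congr 1; omega
  conv_lhs => rw [h]
  rw [← prefixSum_half, prefixSum_zero]
  rfl

/-- The (rounded) probability of appending `0` after the prefix `y↾k`, computed from the two child
prefix sums `S_{y↾k 0}`, `S_{y↾k 1}` — the quantity the machine evaluates at step `k`.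
[cite: BremnerMontanaroShepherd2017, §3.2 (procedure, step 2)] -/
def stepWeight (R : ℝ → ℝ) (p : (Fin N → Bool) → ℝ) (k : ℕ) (y : ℕ → Bool) : ℝ :=
  R (branchWeight (prefixSum p (k + 1) (Function.update y k false))
    (prefixSum p (k + 1) (Function.update y k true)))

/-- The probability of the `k`-th decision along the point `x`. [cite: BremnerMontanaroShepherd2017, §3.2] -/
def stepProb (R : ℝ → ℝ) (p : (Fin N → Bool) → ℝ) (k : ℕ) (x : Fin N → Bool) : ℝ :=
  if extendFin x k = true then 1 - stepWeight R p k (extendFin x) else stepWeight R p k (extendFin x)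

/-- The first step weight is the recursive one. [folklore] -/
theorem stepWeight_zero (R : ℝ → ℝ) (p : (Fin (N + 1) → Bool) → ℝ) (y : ℕ → Bool) :
    stepWeight R p 0 y = R (branchWeight (tot (half p false)) (tot (half p true))) := by
  unfold stepWeight
  rw [prefixSum_one_eq_tot_half, prefixSum_one_eq_tot_half]
  simp

/-- Shifting the steps behind the first bit. [folklore] -/
theorem stepWeight_half (R : ℝ → ℝ) (p : (Fin (N + 1) → Bool) → ℝ) (b : Bool) (k : ℕ) (y : ℕ → Bool) :
    stepWeight R (half p b) k y = stepWeight R p (k + 1) (consN b y) := by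
  unfold stepWeight
  rw [prefixSum_half, prefixSum_half, update_consN_succ, update_consN_succ]

/-- **The recursive sampler is the iterative one**: `Alg_R(p)(x) = ∏_{k<N}` (probability of the
`k`-th decision given the prefix `x↾k`, from the prefix sums). [cite: BremnerMontanaroShepherd2017, §3.2 (the enumerated procedure defines Alg)] -/
theorem algR_eq_prod_stepProb (R : ℝ → ℝ) : ∀ (N : ℕ) (p : (Fin N → Bool) → ℝ) (x : Fin N → Bool),
    algR R N p x = ∏ k : Fin N, stepProb R p k x
  | 0, p, x => by simp [algR]
  | N + 1, p, x => by
    have hx : x = Fin.cons (x 0) (Fin.tail x) := (Fin.cons_self_tail x).symm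
    rw [hx, algR_succ_cons, algR_eq_prod_stepProb R N, Fin.prod_univ_succ]
    congr 1
    · simp [stepProb, stepWeight_zero]
    · refine Finset.prod_congr rfl fun k _ => ?_
      simp only [stepProb, extendFin_cons, Fin.val_succ, stepWeight_half]
      simp [consN]

/-! ### Packaging -/

/-- The output law of the (rounded) sampler as a `PMF` on `{0,1}^N`.
[cite: BremnerMontanaroShepherd2017, §3.2 (Alg(p') as a probability distribution)] -/
def algPMF {R : ℝ → ℝ} (hR : RoundingOK R) (N : ℕ) (p : (Fin N → Bool) → ℝ) : PMF (Fin N → Bool) :=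
  PMF.ofFintype (fun x => ENNReal.ofReal (algR R N p x)) (by
    rw [← ENNReal.ofReal_sum_of_nonneg (fun x _ => algR_nonneg hR N p x), sum_algR, ENNReal.ofReal_one])

/-- Masses of `algPMF`. [folklore] -/
theorem toReal_algPMF_apply {R : ℝ → ℝ} (hR : RoundingOK R) (N : ℕ) (p : (Fin N → Bool) → ℝ)
    (x : Fin N → Bool) : (algPMF hR N p x).toReal = algR R N p x := by
  simp [algPMF, PMF.ofFintype_apply, ENNReal.toReal_ofReal (algR_nonneg hR N p x)]

/-- Total variation is invariant under an injective relabelling (here: reading `{0,1}^N` as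
strings with `List.ofFn`). [folklore] -/
theorem tvDist_map_of_injective {α β : Type*} (p q : PMF α) {f : α → β} (hf : Function.Injective f) :
    (p.map f).tvDist (q.map f) = p.tvDist q := by
  unfold PMF.tvDist
  congr 1
  symm
  have hsupp : Function.support (fun b => |((p.map f) b).toReal - ((q.map f) b).toReal|) ⊆ Set.range f := by
    intro b hb
    by_contra hr
    apply hb
    simp [pmfMap_apply_of_not_mem_range p f hr, pmfMap_apply_of_not_mem_range q f hr]
  rw [← hf.tsum_eq hsupp]
  congr 1
  funext a
  rw [Literature.Computability.QuantumComplexity.pmf_map_apply_of_injective p hf,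
    Literature.Computability.QuantumComplexity.pmf_map_apply_of_injective q hf]

/-- Total variation of two laws on `{0,1}^N` given by real mass vectors is half their `ℓ₁` distance.
[cite: Goldreich2001, §3.2.1 (Definition of statistical distance)] -/
theorem tvDist_eq_half_l1 (μ ν : PMF (Fin N → Bool)) :
    μ.tvDist ν = 2⁻¹ * ∑ x, |(μ x).toReal - (ν x).toReal| := by
  unfold PMF.tvDist
  rw [tsum_fintype]

/-! ### Running the iterative sampler on independent coin blocks

A machine realises the sampler by reading one fresh block of coins per decided bit: with a
decision rule `F k y c` (bit `k` given the prefix `y↾k` and the coin block `c ∈ C`), the output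
on the coin sequence `u` is built by `iterOut`. If, for every step and prefix, the fraction of
coin blocks on which the rule appends `0` is the rounded step weight, then the output law under
uniform independent blocks is `Alg_R` (`card_runOut_eq_prod`, `uniform_map_runOut_eq_algPMF`). -/

section Coins

variable {C : Type*} [Fintype C] [Inhabited C]

/-- The prefix after `k` decisions, driven by the coin blocks `u 0, u 1, …`
(positions `≥ k` are still `false`). [cite: BremnerMontanaroShepherd2017, §3.2 (procedure, step 2: "for i = 1, …, n")] -/
def iterOut (F : ℕ → (ℕ → Bool) → C → Bool) (u : ℕ → C) : ℕ → (ℕ → Bool)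
  | 0 => fun _ => false
  | k + 1 => Function.update (iterOut F u k) k (F k (iterOut F u k) (u k))

/-- Coin blocks indexed by `Fin N`, extended by a default block. [folklore] -/
def extC (u : Fin N → C) : ℕ → C := fun i => if h : i < N then u ⟨i, h⟩ else default

/-- The output point after `N` decisions. [cite: BremnerMontanaroShepherd2017, §3.2 (procedure, step 3)] -/
def runOut (F : ℕ → (ℕ → Bool) → C → Bool) (N : ℕ) (u : Fin N → C) : Fin N → Bool :=
  fun i => iterOut F (extC u) N i

/-- Truncating a prefix function at `k`. [folklore] -/
def truncN (k : ℕ) (y : ℕ → Bool) : ℕ → Bool := fun i => if i < k then y i else false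

omit [Fintype C] [Inhabited C] in
/-- Positions not yet decided are `false`. [folklore] -/
theorem iterOut_apply_of_le (F : ℕ → (ℕ → Bool) → C → Bool) (u : ℕ → C) :
    ∀ (k i : ℕ), k ≤ i → iterOut F u k i = false
  | 0, i, _ => rfl
  | k + 1, i, h => by
    rw [iterOut, Function.update_of_ne (by omega)]
    exact iterOut_apply_of_le F u k i (by omega)

omit [Fintype C] [Inhabited C] in
/-- Decided positions are never revised. [folklore] -/
theorem iterOut_apply_of_lt (F : ℕ → (ℕ → Bool) → C → Bool) (u : ℕ → C) (k : ℕ) :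
    ∀ (d i : ℕ), i < k → iterOut F u (k + d) i = iterOut F u k i
  | 0, i, _ => rfl
  | d + 1, i, hi => by
    rw [← add_assoc, iterOut, Function.update_of_ne (by omega)]
    exact iterOut_apply_of_lt F u k d i hi

omit [Fintype C] [Inhabited C] in
/-- The first `k` decisions only read the first `k` coin blocks. [folklore] -/
theorem iterOut_congr (F : ℕ → (ℕ → Bool) → C → Bool) {u v : ℕ → C} :
    ∀ k : ℕ, (∀ j, j < k → u j = v j) → iterOut F u k = iterOut F v k
  | 0, _ => rfl
  | k + 1, h => by
    rw [iterOut, iterOut, iterOut_congr F k (fun j hj => h j (by omega)), h k (by omega)]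

omit [Fintype C] [Inhabited C] in
/-- Truncation is idempotent. [folklore] -/
theorem truncN_idem (k : ℕ) (y : ℕ → Bool) : truncN k (truncN k y) = truncN k y := by
  funext i; by_cases hi : i < k <;> simp [truncN, hi]

omit [Fintype C] in
/-- Along a run with output `a`, the prefix after `k ≤ N` steps is `a↾k`. [folklore] -/
theorem iterOut_eq_truncN (F : ℕ → (ℕ → Bool) → C → Bool) {u : Fin N → C} {a : Fin N → Bool}
    (h : runOut F N u = a) {k : ℕ} (hk : k ≤ N) : iterOut F (extC u) k = truncN k (extendFin a) := by
  funext i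
  unfold truncN extendFin
  by_cases hi : i < k
  · rw [if_pos hi, dif_pos (by omega)]
    have := congrFun h ⟨i, by omega⟩
    simp only [runOut] at this
    rw [← this]
    obtain ⟨d, rfl⟩ := Nat.exists_eq_add_of_le hk
    exact (iterOut_apply_of_lt F (extC u) k d i hi).symm
  · rw [if_neg hi]
    exact iterOut_apply_of_le F _ k i (by omega)

/-- **Counting the runs with a given output**: the number of coin sequences producing `a` is the
product over the steps of the number of coin blocks on which the rule, fed the true prefix `a↾k`,
appends `a_k`. [folklore] -/
theorem card_runOut_eq_prod (F : ℕ → (ℕ → Bool) → C → Bool) : ∀ (N : ℕ) (a : Fin N → Bool),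
    (univ.filter fun u : Fin N → C => runOut F N u = a).card =
      ∏ k : Fin N, (univ.filter fun c : C => F k (truncN k (extendFin a)) c = a k).card
  | 0, a => by
    rw [Fin.prod_univ_zero, Finset.card_eq_one]
    refine ⟨fun i => i.elim0, ?_⟩
    ext u
    simp only [Finset.mem_filter, Finset.mem_univ, true_and, Finset.mem_singleton]
    constructor
    · intro _; funext i; exact i.elim0
    · intro _; funext i; exact i.elim0
  | N + 1, a => by
    rw [Fin.prod_univ_castSucc]
    -- the previous steps, with output `a ∘ castSucc`
    have ih := card_runOut_eq_prod F N (fun i => a i.castSucc)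
    have hext : (extendFin fun i : Fin N => a i.castSucc) = truncN N (extendFin a) := by
      funext i; simp only [extendFin, truncN]
      by_cases hi : i < N
      · rw [dif_pos hi, if_pos hi, dif_pos (by omega)]; rfl
      · rw [dif_neg hi, if_neg hi]
    have htr : ∀ k : Fin N, truncN k (extendFin fun i : Fin N => a i.castSucc) = truncN k (extendFin a) := by
      intro k; rw [hext]; funext i; simp only [truncN]
      by_cases hi : i < (k : ℕ)
      · rw [if_pos hi, if_pos hi, if_pos (by omega)]
      · rw [if_neg hi, if_neg hi]
    simp_rw [htr] at ih
    simp only [Fin.val_castSucc]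
    rw [← ih, ← Finset.card_product, ← Finset.filter_product]
    -- bijection `u ↦ (u ∘ castSucc, u last)`
    symm
    refine Finset.card_equiv ((Equiv.prodComm _ _).trans (Fin.snocEquiv fun _ => C)) fun q => ?_
    obtain ⟨u', c⟩ := q
    simp only [Finset.mem_filter, Finset.mem_product, Finset.mem_univ, true_and, Equiv.trans_apply,
      Equiv.prodComm_apply, Prod.swap_prod_mk, Fin.snocEquiv, Equiv.coe_fn_mk]
    -- the run on `snoc u' c` agrees with the run on `u'` for `N` steps
    have hagree : ∀ j, j < N → extC (Fin.snoc u' c : Fin (N + 1) → C) j = extC u' j := by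
      intro j hj
      unfold extC
      rw [dif_pos (by omega), dif_pos hj]
      exact Fin.snoc_castSucc (α := fun _ => C) c u' ⟨j, hj⟩
    have hN : iterOut F (extC (Fin.snoc u' c : Fin (N + 1) → C)) N = iterOut F (extC u') N :=
      iterOut_congr F N hagree
    have hlast : extC (Fin.snoc u' c : Fin (N + 1) → C) N = c := by
      unfold extC; rw [dif_pos (Nat.lt_succ_self N)]; exact Fin.snoc_last (α := fun _ => C) c u'
    constructor
    · rintro ⟨h1, h2⟩
      funext i
      refine Fin.lastCases ?_ (fun j => ?_) i
      · show iterOut F _ (N + 1) (Fin.last N) = a (Fin.last N)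
        rw [iterOut, Fin.val_last, Function.update_self, hN, hlast, iterOut_eq_truncN F h1 le_rfl, hext,
          truncN_idem]
        simpa only [Fin.val_last] using h2
      · show iterOut F _ (N + 1) (Fin.castSucc j) = a (Fin.castSucc j)
        rw [Fin.val_castSucc, iterOut_apply_of_lt F _ N 1 j j.2, hN]
        exact congrFun h1 j
    · intro h
      have h1 : runOut F N u' = fun i => a i.castSucc := by
        funext j
        have := congrFun h (Fin.castSucc j)
        simp only [runOut, Fin.val_castSucc] at this ⊢
        rw [iterOut_apply_of_lt F _ N 1 j j.2, hN] at this
        exact this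
      refine ⟨h1, ?_⟩
      have := congrFun h (Fin.last N)
      simp only [runOut, Fin.val_last] at this
      rw [iterOut, Function.update_self, hN, hlast, iterOut_eq_truncN F h1 le_rfl, hext, truncN_idem] at this
      simpa only [Fin.val_last] using this

/-- Prefix sums only read the prefix. [folklore] -/
theorem prefixSum_congr (q : (Fin N → Bool) → ℝ) (k : ℕ) {y y' : ℕ → Bool} (h : ∀ i, i < k → y i = y' i) :
    prefixSum q k y = prefixSum q k y' := by
  unfold prefixSum
  congr 1
  ext x
  simp only [mem_prefixCube]
  exact forall_congr' fun i => imp_congr_right fun hi => by rw [h i hi]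

/-- The step weight only reads the prefix. [folklore] -/
theorem stepWeight_congr (R : ℝ → ℝ) (q : (Fin N → Bool) → ℝ) (k : ℕ) {y y' : ℕ → Bool}
    (h : ∀ i, i < k → y i = y' i) : stepWeight R q k y = stepWeight R q k y' := by
  unfold stepWeight
  rw [prefixSum_congr q (k + 1) (y' := Function.update y' k false),
    prefixSum_congr q (k + 1) (y := Function.update y k true) (y' := Function.update y' k true)]
  all_goals
    intro i hi
    by_cases hik : i = k
    · subst hik; simp
    · rw [Function.update_of_ne hik, Function.update_of_ne hik, h i (by omega)]

/-- **The output law of the coin-driven run is `Alg_R`**: if at every step and prefix the rule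
appends `0` on exactly a `stepWeight R q k y` fraction of the coin blocks, then under uniform
independent coin blocks the output is distributed as `Alg_R(q)`. [folklore] -/
theorem card_runOut_div_eq_algR {R : ℝ → ℝ} (F : ℕ → (ℕ → Bool) → C → Bool) (q : (Fin N → Bool) → ℝ)
    (hF : ∀ k, k < N → ∀ y : ℕ → Bool,
      ((univ.filter fun c : C => F k y c = false).card : ℝ) = Fintype.card C * stepWeight R q k y)
    (a : Fin N → Bool) :
    ((univ.filter fun u : Fin N → C => runOut F N u = a).card : ℝ) / (Fintype.card C : ℝ) ^ N = algR R N q a := by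
  have hC : (0 : ℝ) < Fintype.card C := by exact_mod_cast Fintype.card_pos
  have hpow : (Fintype.card C : ℝ) ^ N = ∏ _k : Fin N, (Fintype.card C : ℝ) := by
    rw [Finset.prod_const, Finset.card_univ, Fintype.card_fin]
  rw [card_runOut_eq_prod, algR_eq_prod_stepProb, Nat.cast_prod, hpow, ← Finset.prod_div_distrib]
  refine Finset.prod_congr rfl fun k _ => ?_
  rw [stepProb, stepWeight_congr R q k (y' := truncN k (extendFin a)) (fun i hi => by simp [truncN, hi])]
  have hsplit : ((univ.filter fun c : C => F k (truncN k (extendFin a)) c = true).card : ℝ) =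
      Fintype.card C - (univ.filter fun c : C => F k (truncN k (extendFin a)) c = false).card := by
    have := Finset.card_filter_add_card_filter_not (s := (univ : Finset C))
      (fun c => F k (truncN k (extendFin a)) c = false)
    rw [Finset.card_univ] at this
    simp only [Bool.not_eq_false] at this
    have h' : ((univ.filter fun c : C => F k (truncN k (extendFin a)) c = false).card : ℝ) +
        ((univ.filter fun c : C => F k (truncN k (extendFin a)) c = true).card : ℝ) = Fintype.card C := by
      exact_mod_cast this
    linarith
  cases hak : a k
  · rw [if_neg (by simp [extendFin, hak]), hF k k.2, mul_div_cancel_left₀ _ hC.ne']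
  · rw [if_pos (by simp [extendFin, hak]), hsplit, hF k k.2, sub_div, mul_div_cancel_left₀ _ hC.ne', div_self hC.ne']

end Coins

end Literature.Barriers.QuantumAdvantage

end
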